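import Summits.ValiantsHypothesis.ValiantsHypothesis.Theorems.DefinabilityGapPivotGoodLines
import Summits.ValiantsHypothesis.ValiantsHypothesis.Theorems.DefinabilityGapPivotLiveBad
import HarnessLib

/-!
# Definability gap, ROAD P: crowded lines are few; bad lines are crowded (N1 v2 (b), deterministic)

The few-bad certificate `kiPivotCertificate_of_fewBad` tolerates bad rows / columns of a minor as
long as they are FEW.  This file supplies the deterministic half of that count (PLAN-N1-v2 (b)):

* `rowHeavy T c M i` / `colHeavy T c M j` — the `M`-heavy ("medium") positions of row `i` /
  column `j` of the block of `c`; `lightCols` / `lightRows` — the complementary light positions;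
* `crowdedRows T c M L` / `crowdedCols T c M L` — lines with at least `L` heavy positions, and the
  incidence count `M · L · #crowdedRows ≤ 2 (#T − 1)` (`mul_card_crowdedRows_le`, same for
  columns): with `M = m/8`, `L = m/4`, `#T ≤ 4m² + 5` a curve has `O(1)` crowded lines;
* the split of a line's killed cells into heavy ones (conceded) and light ones (controlled by the
  restricted kill sums of `DefinabilityGapPivotGoodLines`):
  `card_deadCols_le_heavy_add_sum_rowKillOn`, `card_killedRows_le_heavy_add_sum_colKillOn`;
* **bad ⊆ crowded**: if every non-crowded row (column) satisfies `2 (L + light kill sum) ≤ m`,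
  then `badRows ⊆ crowdedRows` (`badRows_subset_crowdedRows`) and `badCols ⊆ crowdedCols`
  (`badCols_subset_crowdedCols`); hence `M · L · #badRows ≤ 2 (#T − 1)` etc.
-/

namespace Summit.ValiantsHypothesis.ValiantsHypothesis.Theorems.DefinabilityGapPivotCrowded

open Finset Real
open Literature.Computability.AlgebraicComplexity Literature.Computability.MetaComplexity
open Literature.Probability.Moments
open Summit.ValiantsHypothesis.ValiantsHypothesis.Theorems.DefinabilityGapAffineRung
open Summit.ValiantsHypothesis.ValiantsHypothesis.Theorems.DefinabilityGapPivotCertificate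
open Summit.ValiantsHypothesis.ValiantsHypothesis.Theorems.DefinabilityGapPivotLive
open Summit.ValiantsHypothesis.ValiantsHypothesis.Theorems.DefinabilityGapPivotLiveWeak
open Summit.ValiantsHypothesis.ValiantsHypothesis.Theorems.DefinabilityGapPivotLiveBad
open Summit.ValiantsHypothesis.ValiantsHypothesis.Theorems.DefinabilityGapPivotAdmissible
open Summit.ValiantsHypothesis.ValiantsHypothesis.Theorems.DefinabilityGapPivotRandom
open Summit.ValiantsHypothesis.ValiantsHypothesis.Theorems.DefinabilityGapPivotGoodLines

variable {m : ℕ}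

/-! ## 1. Heavy and light positions of a line; crowded lines -/

/-- The `M`-heavy positions of row `i` of the block of `c` (as column indices). [this file] -/
noncomputable def rowHeavy (T : Finset (Fin 3 → Fin (qOf m))) (c : Fin 3 → Fin (qOf m)) (M : ℕ)
    (i : Fin m) : Finset (Fin m) :=
  univ.filter fun j => M ≤ (coCurves T c (i, j)).card

/-- The `M`-light positions of row `i` (fewer than `M` co-curves). [this file] -/
noncomputable def lightCols (T : Finset (Fin 3 → Fin (qOf m))) (c : Fin 3 → Fin (qOf m)) (M : ℕ)
    (i : Fin m) : Finset (Fin m) :=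
  univ.filter fun j => (coCurves T c (i, j)).card < M

/-- The `M`-heavy positions of column `j` of the block of `c` (as row indices). [this file] -/
noncomputable def colHeavy (T : Finset (Fin 3 → Fin (qOf m))) (c : Fin 3 → Fin (qOf m)) (M : ℕ)
    (j : Fin m) : Finset (Fin m) :=
  univ.filter fun i => M ≤ (coCurves T c (i, j)).card

/-- The `M`-light positions of column `j`. [this file] -/
noncomputable def lightRows (T : Finset (Fin 3 → Fin (qOf m))) (c : Fin 3 → Fin (qOf m)) (M : ℕ)
    (j : Fin m) : Finset (Fin m) :=
  univ.filter fun i => (coCurves T c (i, j)).card < M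

/-- CROWDED ROWS: at least `L` heavy positions. [this file] -/
noncomputable def crowdedRows (T : Finset (Fin 3 → Fin (qOf m))) (c : Fin 3 → Fin (qOf m))
    (M L : ℕ) : Finset (Fin m) :=
  univ.filter fun i => L ≤ (rowHeavy T c M i).card

/-- CROWDED COLUMNS: at least `L` heavy positions. [this file] -/
noncomputable def crowdedCols (T : Finset (Fin 3 → Fin (qOf m))) (c : Fin 3 → Fin (qOf m))
    (M L : ℕ) : Finset (Fin m) :=
  univ.filter fun j => L ≤ (colHeavy T c M j).card

/-- Membership in `rowHeavy`. [this file] -/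
theorem mem_rowHeavy {T : Finset (Fin 3 → Fin (qOf m))} {c : Fin 3 → Fin (qOf m)} {M : ℕ}
    {i j : Fin m} : j ∈ rowHeavy T c M i ↔ M ≤ (coCurves T c (i, j)).card := by
  simp [rowHeavy]

/-- Membership in `lightCols`. [this file] -/
theorem mem_lightCols {T : Finset (Fin 3 → Fin (qOf m))} {c : Fin 3 → Fin (qOf m)} {M : ℕ}
    {i j : Fin m} : j ∈ lightCols T c M i ↔ (coCurves T c (i, j)).card < M := by
  simp [lightCols]

/-- Membership in `colHeavy`. [this file] -/
theorem mem_colHeavy {T : Finset (Fin 3 → Fin (qOf m))} {c : Fin 3 → Fin (qOf m)} {M : ℕ}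
    {i j : Fin m} : i ∈ colHeavy T c M j ↔ M ≤ (coCurves T c (i, j)).card := by
  simp [colHeavy]

/-- Membership in `lightRows`. [this file] -/
theorem mem_lightRows {T : Finset (Fin 3 → Fin (qOf m))} {c : Fin 3 → Fin (qOf m)} {M : ℕ}
    {i j : Fin m} : i ∈ lightRows T c M j ↔ (coCurves T c (i, j)).card < M := by
  simp [lightRows]

/-- Membership in `crowdedRows`. [this file] -/
theorem mem_crowdedRows {T : Finset (Fin 3 → Fin (qOf m))} {c : Fin 3 → Fin (qOf m)} {M L : ℕ}
    {i : Fin m} : i ∈ crowdedRows T c M L ↔ L ≤ (rowHeavy T c M i).card := by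
  simp [crowdedRows]

/-- Membership in `crowdedCols`. [this file] -/
theorem mem_crowdedCols {T : Finset (Fin 3 → Fin (qOf m))} {c : Fin 3 → Fin (qOf m)} {M L : ℕ}
    {j : Fin m} : j ∈ crowdedCols T c M L ↔ L ≤ (colHeavy T c M j).card := by
  simp [crowdedCols]

/-! ## 2. Crowded lines are few -/

/-- The heavy positions, counted row by row, are the heavy cells. [this file] -/
theorem sum_card_rowHeavy (T : Finset (Fin 3 → Fin (qOf m))) (c : Fin 3 → Fin (qOf m)) (M : ℕ) :
    ∑ i, (rowHeavy T c M i).card = (heavyCells T c M).card := by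
  classical
  unfold rowHeavy heavyCells
  simp only [Finset.card_filter]
  rw [Fintype.sum_prod_type]

/-- The heavy positions, counted column by column, are the heavy cells. [this file] -/
theorem sum_card_colHeavy (T : Finset (Fin 3 → Fin (qOf m))) (c : Fin 3 → Fin (qOf m)) (M : ℕ) :
    ∑ j, (colHeavy T c M j).card = (heavyCells T c M).card := by
  classical
  unfold colHeavy heavyCells
  simp only [Finset.card_filter]
  rw [Fintype.sum_prod_type, Finset.sum_comm]

/-- `L · #crowdedRows ≤ #heavyCells`. [this file] -/
theorem mul_card_crowdedRows_le_heavyCells (T : Finset (Fin 3 → Fin (qOf m)))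
    (c : Fin 3 → Fin (qOf m)) (M L : ℕ) :
    L * (crowdedRows T c M L).card ≤ (heavyCells T c M).card := by
  classical
  rw [← sum_card_rowHeavy T c M]
  have h1 := Finset.card_nsmul_le_sum (crowdedRows T c M L) (fun i => (rowHeavy T c M i).card) L
    fun i hi => mem_crowdedRows.mp hi
  rw [smul_eq_mul, mul_comm] at h1
  exact h1.trans (Finset.sum_le_sum_of_subset_of_nonneg (Finset.subset_univ _) fun _ _ _ =>
    Nat.zero_le _)

/-- `L · #crowdedCols ≤ #heavyCells`. [this file] -/
theorem mul_card_crowdedCols_le_heavyCells (T : Finset (Fin 3 → Fin (qOf m)))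
    (c : Fin 3 → Fin (qOf m)) (M L : ℕ) :
    L * (crowdedCols T c M L).card ≤ (heavyCells T c M).card := by
  classical
  rw [← sum_card_colHeavy T c M]
  have h1 := Finset.card_nsmul_le_sum (crowdedCols T c M L) (fun j => (colHeavy T c M j).card) L
    fun j hj => mem_crowdedCols.mp hj
  rw [smul_eq_mul, mul_comm] at h1
  exact h1.trans (Finset.sum_le_sum_of_subset_of_nonneg (Finset.subset_univ _) fun _ _ _ =>
    Nat.zero_le _)

/-- **Few crowded rows**: `M · L · #crowdedRows ≤ 2 (#T − 1)`. [this file] -/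
theorem mul_card_crowdedRows_le (T : Finset (Fin 3 → Fin (qOf m))) (c : Fin 3 → Fin (qOf m))
    (M L : ℕ) : M * L * (crowdedRows T c M L).card ≤ 2 * (T.erase c).card := by
  rw [mul_assoc]
  exact (Nat.mul_le_mul_left M (mul_card_crowdedRows_le_heavyCells T c M L)).trans
    (mul_card_heavyCells_le T c M)

/-- **Few crowded columns**: `M · L · #crowdedCols ≤ 2 (#T − 1)`. [this file] -/
theorem mul_card_crowdedCols_le (T : Finset (Fin 3 → Fin (qOf m))) (c : Fin 3 → Fin (qOf m))
    (M L : ℕ) : M * L * (crowdedCols T c M L).card ≤ 2 * (T.erase c).card := by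
  rw [mul_assoc]
  exact (Nat.mul_le_mul_left M (mul_card_crowdedCols_le_heavyCells T c M L)).trans
    (mul_card_heavyCells_le T c M)

/-! ## 3. Killed cells of a line: heavy part conceded, light part = restricted kill sum -/

/-- The killed cells of a row split into heavy ones and killed light ones. [this file] -/
theorem card_deadCols_le_heavy_add_light (W : Finset (Fin (qOf m) × Fin (qOf m)))
    (T : Finset (Fin 3 → Fin (qOf m))) (c : Fin 3 → Fin (qOf m)) (M : ℕ) (s₀ i : Fin m) :
    (deadCols W c s₀ i).card ≤
      (rowHeavy T c M i).card + (deadCols W c s₀ i ∩ lightCols T c M i).card := by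
  classical
  refine (Finset.card_le_card fun j hj => ?_).trans (Finset.card_union_le _ _)
  rcases le_or_gt M (coCurves T c (i, j)).card with h | h
  · exact Finset.mem_union_left _ (mem_rowHeavy.mpr h)
  · exact Finset.mem_union_right _ (Finset.mem_inter.mpr ⟨hj, mem_lightCols.mpr h⟩)

/-- **Row split under the gadget zeros**: killed cells of row `i ≠ r c` of the minor of `c` are at
most the heavy positions plus the light kill sum. [this file] -/
theorem card_deadCols_le_heavy_add_sum_rowKillOn (T : Finset (Fin 3 → Fin (qOf m))) (s₀ : Fin m)
    (r : (Fin 3 → Fin (qOf m)) → Fin m) (c : Fin 3 → Fin (qOf m)) (M : ℕ) {i : Fin m}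
    (hi : i ≠ r c) :
    ((deadCols (pivotZeros m T s₀ r) c s₀ i).card : ℝ) ≤
      (rowHeavy T c M i).card +
        ∑ c' : Fin 3 → Fin (qOf m), rowKillOn (lightCols T c M i) T c i c' (r c') := by
  have h1 := card_deadCols_le_heavy_add_light (pivotZeros m T s₀ r) T c M s₀ i
  have h2 := card_deadCols_inter_le_sum_rowKillOn (lightCols T c M i) T s₀ r c hi
  have h1' : ((deadCols (pivotZeros m T s₀ r) c s₀ i).card : ℝ) ≤
      (rowHeavy T c M i).card + ((deadCols (pivotZeros m T s₀ r) c s₀ i ∩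
        lightCols T c M i).card : ℝ) := by exact_mod_cast h1
  linarith

/-- The killed rows of column `j` of the minor (row `r c` deleted). [this file] -/
noncomputable def killedRows (W : Finset (Fin (qOf m) × Fin (qOf m))) (c : Fin 3 → Fin (qOf m))
    (r j : Fin m) : Finset (Fin m) :=
  univ.filter fun i => i ≠ r ∧ cellEmb m c (i, j) ∈ W

/-- Membership in `killedRows`. [this file] -/
theorem mem_killedRows {W : Finset (Fin (qOf m) × Fin (qOf m))} {c : Fin 3 → Fin (qOf m)}
    {r j i : Fin m} : i ∈ killedRows W c r j ↔ i ≠ r ∧ cellEmb m c (i, j) ∈ W := by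
  simp [killedRows]

/-- Free plus killed rows of a column of the minor cover the `m − 1` rows `≠ r`:
`m ≤ #okRows + #killedRows + 1`. [this file] -/
theorem le_card_okRows_add_killedRows (W : Finset (Fin (qOf m) × Fin (qOf m)))
    (c : Fin 3 → Fin (qOf m)) (r j : Fin m) :
    m ≤ (okRows W c r j).card + (killedRows W c r j).card + 1 := by
  classical
  have hsub : (univ.erase r : Finset (Fin m)) ⊆ okRows W c r j ∪ killedRows W c r j := by
    intro i hi
    have hir : i ≠ r := (Finset.mem_erase.mp hi).1
    by_cases hW : cellEmb m c (i, j) ∈ W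
    · exact Finset.mem_union_right _ (mem_killedRows.mpr ⟨hir, hW⟩)
    · exact Finset.mem_union_left _ (mem_okRows.mpr ⟨hir, hW⟩)
  have h1 := (Finset.card_le_card hsub).trans (Finset.card_union_le _ _)
  have h2 : (univ.erase r : Finset (Fin m)).card = m - 1 := by
    rw [Finset.card_erase_of_mem (Finset.mem_univ r), Finset.card_univ, Fintype.card_fin]
  omega

/-- The killed rows of a column split into heavy ones and killed light ones. [this file] -/
theorem card_killedRows_le_heavy_add_light (W : Finset (Fin (qOf m) × Fin (qOf m)))
    (T : Finset (Fin 3 → Fin (qOf m))) (c : Fin 3 → Fin (qOf m)) (M : ℕ) (r j : Fin m) :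
    (killedRows W c r j).card ≤
      (colHeavy T c M j).card +
        ((lightRows T c M j).filter fun i => i ≠ r ∧ cellEmb m c (i, j) ∈ W).card := by
  classical
  refine (Finset.card_le_card fun i hi => ?_).trans (Finset.card_union_le _ _)
  rcases le_or_gt M (coCurves T c (i, j)).card with h | h
  · exact Finset.mem_union_left _ (mem_colHeavy.mpr h)
  · exact Finset.mem_union_right _
      (Finset.mem_filter.mpr ⟨mem_lightRows.mpr h, mem_killedRows.mp hi⟩)

/-- **Column split under the gadget zeros**: killed rows of column `j` of the minor of `c` are at
most the heavy positions plus the light kill sum. [this file] -/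
theorem card_killedRows_le_heavy_add_sum_colKillOn (T : Finset (Fin 3 → Fin (qOf m)))
    (s₀ : Fin m) (r : (Fin 3 → Fin (qOf m)) → Fin m) (c : Fin 3 → Fin (qOf m)) (M : ℕ)
    (j : Fin m) :
    ((killedRows (pivotZeros m T s₀ r) c (r c) j).card : ℝ) ≤
      (colHeavy T c M j).card +
        ∑ c' : Fin 3 → Fin (qOf m), colKillOn (lightRows T c M j) T c j c' (r c') := by
  have h1 := card_killedRows_le_heavy_add_light (pivotZeros m T s₀ r) T c M (r c) j
  have h2 := card_killedRows_on_le_sum_colKillOn (lightRows T c M j) T s₀ r c j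
  have h1' : ((killedRows (pivotZeros m T s₀ r) c (r c) j).card : ℝ) ≤
      (colHeavy T c M j).card + (((lightRows T c M j).filter fun i =>
        i ≠ r c ∧ cellEmb m c (i, j) ∈ pivotZeros m T s₀ r).card : ℝ) := by exact_mod_cast h1
  linarith

/-! ## 4. Bad lines are crowded -/

/-- **Bad rows are crowded**: if on every non-crowded row `i ≠ r c` the light kill sum `Σ` obeys
`2 (L + Σ) ≤ m`, every bad row (at least `m/2` killed cells) is crowded. [this file] -/
theorem badRows_subset_crowdedRows (T : Finset (Fin 3 → Fin (qOf m))) (s₀ : Fin m)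
    (r : (Fin 3 → Fin (qOf m)) → Fin m) (c : Fin 3 → Fin (qOf m)) (M L : ℕ)
    (hgood : ∀ i, i ≠ r c → i ∉ crowdedRows T c M L →
      2 * ((L : ℝ) + ∑ c' : Fin 3 → Fin (qOf m), rowKillOn (lightCols T c M i) T c i c' (r c'))
        ≤ m) :
    badRows (pivotZeros m T s₀ r) c (r c) s₀ ⊆ crowdedRows T c M L := by
  intro i hi
  obtain ⟨hir, hbad⟩ := mem_badRows.mp hi
  by_contra hnc
  have hL : (rowHeavy T c M i).card + 1 ≤ L := by
    have := mem_crowdedRows.not.mp hnc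
    omega
  have h1 := card_deadCols_le_heavy_add_sum_rowKillOn T s₀ r c M hir
  have h2 := hgood i hir hnc
  have hL' : ((rowHeavy T c M i).card : ℝ) + 1 ≤ L := by exact_mod_cast hL
  have hbad' : (m : ℝ) ≤ 2 * ((deadCols (pivotZeros m T s₀ r) c s₀ i).card : ℝ) := by
    exact_mod_cast hbad
  linarith

/-- **Bad columns are crowded**: if on every non-crowded column `j ≠ s₀` the light kill sum `Σ`
obeys `2 (L + Σ) ≤ m`, every bad column (fewer than `(m − 1)/2` free rows) is crowded.
[this file] -/
theorem badCols_subset_crowdedCols (T : Finset (Fin 3 → Fin (qOf m))) (s₀ : Fin m)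
    (r : (Fin 3 → Fin (qOf m)) → Fin m) (c : Fin 3 → Fin (qOf m)) (M L : ℕ)
    (hgood : ∀ j, j ≠ s₀ → j ∉ crowdedCols T c M L →
      2 * ((L : ℝ) + ∑ c' : Fin 3 → Fin (qOf m), colKillOn (lightRows T c M j) T c j c' (r c'))
        ≤ m) :
    badCols (pivotZeros m T s₀ r) c (r c) s₀ ⊆ crowdedCols T c M L := by
  intro j hj
  obtain ⟨hjs, hbad⟩ := mem_badCols.mp hj
  by_contra hnc
  have hL : (colHeavy T c M j).card + 1 ≤ L := by
    have := mem_crowdedCols.not.mp hnc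
    omega
  have h1 := card_killedRows_le_heavy_add_sum_colKillOn T s₀ r c M j
  have h2 := hgood j hjs hnc
  have h3 := le_card_okRows_add_killedRows (pivotZeros m T s₀ r) c (r c) j
  have hL' : ((colHeavy T c M j).card : ℝ) + 1 ≤ L := by exact_mod_cast hL
  have hbad' : 2 * ((okRows (pivotZeros m T s₀ r) c (r c) j).card : ℝ) + 1 < m := by
    exact_mod_cast hbad
  have h3' : (m : ℝ) ≤ (okRows (pivotZeros m T s₀ r) c (r c) j).card +
      ((killedRows (pivotZeros m T s₀ r) c (r c) j).card : ℝ) + 1 := by exact_mod_cast h3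
  linarith

/-- **Few bad rows** under the good-row hypothesis: `M · L · #badRows ≤ 2 (#T − 1)`. [this file] -/
theorem mul_card_badRows_le (T : Finset (Fin 3 → Fin (qOf m))) (s₀ : Fin m)
    (r : (Fin 3 → Fin (qOf m)) → Fin m) (c : Fin 3 → Fin (qOf m)) (M L : ℕ)
    (hgood : ∀ i, i ≠ r c → i ∉ crowdedRows T c M L →
      2 * ((L : ℝ) + ∑ c' : Fin 3 → Fin (qOf m), rowKillOn (lightCols T c M i) T c i c' (r c'))
        ≤ m) :
    M * L * (badRows (pivotZeros m T s₀ r) c (r c) s₀).card ≤ 2 * (T.erase c).card :=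
  (Nat.mul_le_mul_left (M * L)
    (Finset.card_le_card (badRows_subset_crowdedRows T s₀ r c M L hgood))).trans
    (mul_card_crowdedRows_le T c M L)

/-- **Few bad columns** under the good-column hypothesis: `M · L · #badCols ≤ 2 (#T − 1)`.
[this file] -/
theorem mul_card_badCols_le (T : Finset (Fin 3 → Fin (qOf m))) (s₀ : Fin m)
    (r : (Fin 3 → Fin (qOf m)) → Fin m) (c : Fin 3 → Fin (qOf m)) (M L : ℕ)
    (hgood : ∀ j, j ≠ s₀ → j ∉ crowdedCols T c M L →
      2 * ((L : ℝ) + ∑ c' : Fin 3 → Fin (qOf m), colKillOn (lightRows T c M j) T c j c' (r c'))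
        ≤ m) :
    M * L * (badCols (pivotZeros m T s₀ r) c (r c) s₀).card ≤ 2 * (T.erase c).card :=
  (Nat.mul_le_mul_left (M * L)
    (Finset.card_le_card (badCols_subset_crowdedCols T s₀ r c M L hgood))).trans
    (mul_card_crowdedCols_le T c M L)

end Summit.ValiantsHypothesis.ValiantsHypothesis.Theorems.DefinabilityGapPivotCrowded
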